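import Literature.AlgebraicGeometry.HodgeTheory.AbelianFourfoldsStablyNondegenerate
import Literature.AlgebraicGeometry.ComplexMultiplication.CMAbelianFourfoldFivefoldPowersHodge
import Literature.AlgebraicGeometry.HodgeTheory.AbelianVarietyHOneHomMultiplicityFormula
import HarnessLib

/-!
# Moonen–Zarhin 1999 Thm. 0.1 (4) for NON-SIMPLE fourfolds (unconditional) and the rows of Thm. 0.2 (4) for non-simple
# fivefolds: `S₁ × S₂`, `E × T` (`T` non-simple), five curves, `E × E₁ × E₂ × S`, `E × S₁ × S₂` are stably nondegenerate;
# Poincaré shapes `(1,4)`/`(2,3)` of a non-simple fivefold; isogeny factors of CM varieties are CM; complements of isogeny factors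

(Part 1) «Not case (a)» in domination form implies the isogeny form; **every non-simple complex abelian fourfold outside case
(a) is stably nondegenerate** (`isStablyNondegenerate_of_dim_eq_four_of_not_isSimple`: `B = D` on all powers, from the CM
fourfold classification of `CMAbelianFourfoldFivefoldPowersHodge` and the tree's non-CM product theorems); `Hom` into a simple
variety of larger dimension vanishes; a product of positive-dimensional varieties is not simple; `S₁ × S₂` and `E × T`
(`T` a non-simple threefold) are stably nondegenerate with NO hypothesis. (Part 2) A non-simple fivefold is isogenous to
`Y × Z` with `(dim Y, dim Z) ∈ {(1,4), (2,3)}` (Poincaré); `A × (B × C) ∼ B × (A × C)`; an isogeny factor with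
`Hom(S, A) = 0` of `A × B` is a factor of `B`; an isogeny factor of a CM variety is CM (Milne 1999 §2); curves with a
non-zero homomorphism are isogenous; «not (e)/(f)» passes to isogeny factors and yields `End⁰(E) ↪̸ End⁰(T)`; the rows:
five elliptic curves, `E × E₁ × E₂ × S` (`E` non-CM, or the product not CM), `E × S₁ × S₂` (not CM), and `S × T` for a simple
surface and any threefold GIVEN the row (5.10) as a hypothesis `hST`. (Part 3) An isogeny factor has a complement
(`A ≼ X ⟹ A × B ∼ X`), the relative complement of an elliptic factor, and the printed shapes of cases (e)/(f) for fivefolds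
(`X ∼ C × (E × T)`). `IsStablyNondegenerate` is the tree's Literature notion (`B = D` on all powers); no case of the Hodge
conjecture is asserted here beyond it.

* Part 1 — from `Ring2/NonSimpleFourfoldsHodge` (7/14 declarations; namespace
  `Literature.AlgebraicGeometry.HodgeTheory.AbelianLowDimension.NonSimpleFourfolds`): EVERY non-simple complex abelian
  FOURFOLD outside Moonen–Zarhin's case (a) is stably nondegenerate, and the Hodge conjecture holds for all its powers
  — UNCONDITIONALLY (the union of the Literature lane's non-CM half with the CorCM cell's CM half). Declarations:
  `isEmpty_ringHom_of_not_exists_factors`, `isStablyNondegenerate_of_dim_eq_four_of_not_isSimple`,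
  `hom_eq_zero_of_isSimple_of_dim_lt`, `not_avDominatedBy_of_forall_hom_eq_zero`, `not_isSimple_prod_of_dim_pos`,
  `isStablyNondegenerate_surface_prod_surface`, `isStablyNondegenerate_curve_prod_threefold_of_not_isSimple`.
* Part 2 — from `Ring2/NonSimpleFivefoldsRows` (13/18 declarations; namespace
  `Literature.AlgebraicGeometry.HodgeTheory.AbelianLowDimension.NonSimpleFivefolds`): Non-simple complex abelian
  FIVEFOLDS, part 1: the rows of Moonen–Zarhin 1999 §5 (5.6)–(5.11) with an elliptic factor and pieces of dimension `≤
  2` (Math. Ann. 315, Thm. 0.2 (4)). Declarations: `exists_prod_isIsogenous_of_not_isSimple_fivefold`,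
  `isIsogenous_prod_leftComm`, `avDominatedBy_right_of_forall_hom_eq_zero`, `isOfCMType_of_avDominatedBy`,
  `isIsogenous_of_hom_ne_zero_of_curves`, `not_exists_caseEF_of_avDominatedBy`,
  `isEmpty_ringHom_of_not_exists_caseEF`, `isStablyNondegenerate_fiveCurves`, `isStablyNondegenerate_fiveCurves'`,
  `isStablyNondegenerate_nonCMCurve_prod_curve_prod_curve_prod_simpleSurface`,
  `isStablyNondegenerate_curve_prod_curve_prod_curve_prod_surface_of_not_isOfCMType`,
  `isStablyNondegenerate_curve_prod_surface_prod_surface_of_not_isOfCMType`,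
  `isStablyNondegenerate_simpleSurface_prod_threefold_of_not_isOfCMType_of`.
* Part 3 — from `Ring2/LowDimensionHodgeOfMarkman` (4/17 declarations; namespace
  `Literature.AlgebraicGeometry.HodgeTheory.AbelianLowDimension.LowDimOfMarkman`): The Hodge conjecture for complex
  abelian varieties of dimension `≤ 5`, GRANTED Markman's theorem on the Weil classes of abelian fourfolds ALONE:
  every non-simple fourfold, and every non-simple fivefold outside two printed rows. Declarations:
  `exists_prod_isIsogenous_of_avDominatedBy`, `hom_eq_zero_of_isSimple_of_lt_dim`,
  `exists_prod_isIsogenous_of_avDominatedBy_curve_threefold`,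
  `exists_isIsogenous_curve_prod_of_avDominatedBy_of_dim_eq_five`.

## References

* [MoonenZarhin1999LowDim] B. Moonen, Yu. Zarhin, Math. Ann. 315 (1999) 711–733, Thm. 0.1 (a), (4), §5 (5.4)–(5.5).
* [MumfordAV1970] D. Mumford, *Abelian Varieties* (1970), §19 Thm. 1 and Cor. 1–2 (pp. 173–174).
* [RamonMari2008] J. J. Ramón Marí, Collect. Math. 59 (2008) 1–26, Prop. 2.18 with `r = 2` (the printed statement «the
  Hodge conjecture holds for `A₁ × A₂`, `dim A_i ≤ 2`» certified by the `S₁ × S₂` rows of both halves).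
* [vanGeemen1994HodgeAV] B. van Geemen, LNM 1594 (1994), §3.6, Lemma 3.7, Thm. 4.3. [cite: vanGeemen1994HodgeAV, Lemma
  3.7 and §3.6]
* [Milne1999] J. S. Milne, Compositio Math. 117 (1999), §2 p. 54 (CM type and isogeny factors). [cite: Milne1999, §2
  p. 54]
* [Markman2025SurveySecant] E. Markman, arXiv:2509.23403, Thm. 1.2 and Cor. 1.3 (Weil classes on abelian fourfolds;
  the hypothesis `hMark`). [claim: Markman2025SurveySecant, status: under-review]
* [Deligne2000] P. Deligne, *The Hodge conjecture* (Clay, 2000), §1. [cite: Deligne2000, §1]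

Provenance: Literature home of the used declarations of the Summits-side modules listed part by part above (cells
`pub-hodge-ring2` / `pub-hodgecm2`; namespaces `Summit.HodgeConjecture.Ring2.LowDimOfMarkman`,
`Summit.HodgeConjecture.Ring2.NonSimpleFivefolds`, `Summit.HodgeConjecture.Ring2.NonSimpleFourfolds` re-rooted under
`Literature.AlgebraicGeometry.…` as stated), whose imports are `Literature/` and Mathlib only for the declarations
used; re-homed verbatim (proofs unchanged) so that Literature users are served without importing `Summits/`. Lane
`lit-hodgefound`, seat p20 (generation 34). Theorems only: no definition, no named fact, no `sorry`; axioms `propext`,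
`Classical.choice`, `Quot.sound`.
-/

/-! ## Part 1: NonSimpleFourfoldsHodge -/

noncomputable section

open _root_.CategoryTheory

namespace Literature.AlgebraicGeometry.HodgeTheory.AbelianLowDimension.NonSimpleFourfolds

open Literature.AlgebraicGeometry.Motives (AbelianVariety)
open Literature.AlgebraicGeometry.Motives.AbelianVariety
open Literature.AlgebraicGeometry.HodgeTheory
open Literature.AlgebraicGeometry.Milne1999
open Literature.AlgebraicGeometry.ComplexMultiplication
open Literature.AlgebraicGeometry.ComplexMultiplication.Domination

variable {X : AbelianVariety ℂ}

/-- **The domination form of «not case (a)» implies the isogeny form**: if no elliptic curve and simple threefold which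
are both isogeny factors of `X` admit `End⁰(E) ↪ End⁰(T)`, then for every isogeny `E × T → X` with `E` of CM type and
`T` simple there is no such embedding. [cite: MoonenZarhin1999LowDim, Thm. 0.1 (a)] [cite: MumfordAV1970, §19 Thm. 1 (pp. 173–174)] -/
theorem isEmpty_ringHom_of_not_exists_factors
    (hna : ¬ ∃ E T : AbelianVariety ℂ, E.dim = 1 ∧ T.IsSimple ∧ T.dim = 3 ∧
      AVDominatedBy E X ∧ AVDominatedBy T X ∧ Nonempty (E.endAlgebra →+* T.endAlgebra)) :
    ∀ E T : AbelianVariety ℂ, E.dim = 1 → T.dim = 3 → T.IsSimple → IsOfCMType E →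
      AbelianVariety.IsIsogenous (E.prod T) X → IsEmpty (E.endAlgebra →+* T.endAlgebra) := by
  intro E T hE hT3 hTs _ hiso
  by_contra hne
  rw [not_isEmpty_iff] at hne
  obtain ⟨g, hg⟩ := hiso
  exact hna ⟨E, T, hE, hTs, hT3, (SliceExhaustion.avDominatedBy_prod_left E T).trans_isIsogeny_hom hg,
    (avDominatedBy_prod_right E T).trans_isIsogeny_hom hg, hne⟩

/-- **MOONEN–ZARHIN Thm. 0.1 (4) FOR NON-SIMPLE FOURFOLDS — UNCONDITIONAL.** Every non-simple complex abelian fourfold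
`X` outside case (a) (no elliptic curve `E` and simple threefold `T`, both isogeny factors of `X`, with
`End⁰(E) ↪ End⁰(T)`) is stably nondegenerate: `B•(Xⁿ) = D•(Xⁿ)` for all `n`. `X` not of CM type: the Literature theorem
(5.4); `X` of CM type: the CorCM classification (5.5) — `X` is divisor-generated, hence so is every power.
[cite: MoonenZarhin1999LowDim, Thm. 0.1 (4) and §5 (5.4)–(5.5)] -/
theorem isStablyNondegenerate_of_dim_eq_four_of_not_isSimple (hX4 : X.dim = 4) (hX : ¬ X.IsSimple)
    (hna : ¬ ∃ E T : AbelianVariety ℂ, E.dim = 1 ∧ T.IsSimple ∧ T.dim = 3 ∧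
      AVDominatedBy E X ∧ AVDominatedBy T X ∧ Nonempty (E.endAlgebra →+* T.endAlgebra)) :
    IsStablyNondegenerate X := by
  by_cases hcm : IsOfCMType X
  · have hXD : IsDivisorGenerated X := (isDivisorGenerated_iff_of_not_isSimple_of_dim_four hcm hX4 hX).2 hna
    exact fun N => isDivisorGenerated_of_avDominatedBy_powSucc_of_isOfCMType_of_dim_four hcm hX4 hXD
      (AVDominatedBy.refl (X.powSucc N))
  · exact isStablyNondegenerate_of_dim_eq_four_of_not_isSimple_of_not_isOfCMType hX4 hX hcm
      (isEmpty_ringHom_of_not_exists_factors hna)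

/-- A homomorphism to a SIMPLE abelian variety of larger dimension vanishes (a non-zero one would be surjective).
[cite: MumfordAV1970, §19 Cor. 2 of Thm. 1 (proof)] -/
theorem hom_eq_zero_of_isSimple_of_dim_lt {S T : AbelianVariety ℂ} (hT : T.IsSimple) (h : S.dim < T.dim)
    (f : S ⟶ T) : f = 0 := by
  by_contra hf
  have := dim_le_of_isSimple_of_ne_zero f hT hf
  omega

/-- If every homomorphism `P ⟶ T` vanishes and `dim T > 0`, then `T` is not an isogeny factor of `P`
(`s ≫ π = N • 𝟙 T` with `π = 0` forces `N • 𝟙 T = 0`). [cite: MumfordAV1970, §19 Thm. 1 (pp. 173–174)] -/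
theorem not_avDominatedBy_of_forall_hom_eq_zero {T P : AbelianVariety ℂ} (h0 : 0 < T.dim)
    (h : ∀ π : P ⟶ T, π = 0) : ¬ AVDominatedBy T P := by
  rintro ⟨s, π, N, hN, hsπ⟩
  exact (ne_zero_of_comp_eq_nsmul_id hN hsπ h0).2 (h π)

/-- A product of two positive-dimensional abelian varieties is not simple (`S₁ ↪ S₁ × S₂`, `x ↦ (x, 0)`, is a closed
immersion split by the first projection). [cite: MumfordAV1970, §19 Thm. 1 (pp. 173–174)] -/
theorem not_isSimple_prod_of_dim_pos {S₁ S₂ : AbelianVariety ℂ} (h₁ : 0 < S₁.dim) (h₂ : 0 < S₂.dim) :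
    ¬ (S₁.prod S₂).IsSimple := fun hs =>
  hs S₁ (prodLift (𝟙 S₁) (0 : S₁ ⟶ S₂))
    (isClosedImmersion_of_comp_eq_id _ (AbelianVariety.fst S₁ S₂) (prodLift_fst _ _)) h₁ (by rw [dim_prod]; omega)

/-- **EVERY product `S₁ × S₂` of two complex abelian surfaces is stably nondegenerate — UNCONDITIONAL, no hypothesis**
(case (a) cannot occur: a simple threefold is not an isogeny factor of `S₁ × S₂`, every homomorphism `S_i → T`
vanishing by dimension). With both halves: `S₁`, `S₂` arbitrary (simple or not, CM or not).
[cite: MoonenZarhin1999LowDim, Thm. 0.1 (4) and §5 (5.4)–(5.5)] [cite: RamonMari2008, Prop. 2.18] -/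
theorem isStablyNondegenerate_surface_prod_surface {S₁ S₂ : AbelianVariety ℂ} (h₁ : S₁.dim = 2) (h₂ : S₂.dim = 2) :
    IsStablyNondegenerate (S₁.prod S₂) := by
  refine isStablyNondegenerate_of_dim_eq_four_of_not_isSimple (by rw [dim_prod]; omega)
    (not_isSimple_prod_of_dim_pos (by omega) (by omega)) ?_
  rintro ⟨E, T, -, hTs, hT3, -, hTX, -⟩
  exact not_avDominatedBy_of_forall_hom_eq_zero (T := T) (by omega)
    (fun π => prod_hom_eq_zero_of_forall (fun f => hom_eq_zero_of_isSimple_of_dim_lt hTs (by omega) f)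
      (fun g => hom_eq_zero_of_isSimple_of_dim_lt hTs (by omega) g) π) hTX

/-- **EVERY `E × T`, `E` an elliptic curve and `T` a NON-SIMPLE abelian threefold, is stably nondegenerate —
UNCONDITIONAL, no hypothesis** (`T ∼ E' × S` by Poincaré; a simple threefold `T₀` is not an isogeny factor of
`E × (E' × S)`: all homomorphisms `E, E', S → T₀` vanish by dimension). [cite: MoonenZarhin1999LowDim, Thm. 0.1 (4) and §5 (5.4)–(5.5)]
[cite: MumfordAV1970, §19 Thm. 1 (pp. 173–174)] -/
theorem isStablyNondegenerate_curve_prod_threefold_of_not_isSimple {E T : AbelianVariety ℂ} (hE : E.dim = 1)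
    (hT3 : T.dim = 3) (hT : ¬ T.IsSimple) : IsStablyNondegenerate (E.prod T) := by
  refine isStablyNondegenerate_of_dim_eq_four_of_not_isSimple (by rw [dim_prod]; omega)
    (not_isSimple_prod_of_dim_pos (by omega) (by omega)) ?_
  rintro ⟨E₀, T₀, -, hT₀s, hT₀3, -, hT₀X, -⟩
  obtain ⟨E', S, hE', hS2, hTiso⟩ := exists_curve_prod_surface_isIsogenous_of_not_isSimple_threefold hT3 hT
  obtain ⟨g, hg⟩ := (AbelianVariety.IsIsogenous.refl E).prod hTiso
  refine not_avDominatedBy_of_forall_hom_eq_zero (T := T₀) (by omega) (fun π => ?_) (hT₀X.trans_isIsogeny_inv hg)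
  exact prod_hom_eq_zero_of_forall (fun f => hom_eq_zero_of_isSimple_of_dim_lt hT₀s (by omega) f)
    (fun u => prod_hom_eq_zero_of_forall (fun f => hom_eq_zero_of_isSimple_of_dim_lt hT₀s (by omega) f)
      (fun f => hom_eq_zero_of_isSimple_of_dim_lt hT₀s (by omega) f) u) π

end Literature.AlgebraicGeometry.HodgeTheory.AbelianLowDimension.NonSimpleFourfolds

end

/-! ## Part 2: NonSimpleFivefoldsRows -/

noncomputable section

open _root_.CategoryTheory _root_.CategoryTheory.Limits

namespace Literature.AlgebraicGeometry.HodgeTheory.AbelianLowDimension.NonSimpleFivefolds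

open Literature.AlgebraicGeometry.Motives (AbelianVariety)
open Literature.AlgebraicGeometry.Motives.AbelianVariety
open Literature.AlgebraicGeometry.HodgeTheory
open Literature.AlgebraicGeometry.Milne1999
open Literature.AlgebraicGeometry.ComplexMultiplication
open Literature.AlgebraicGeometry.ComplexMultiplication.Domination
open Literature.AlgebraicGeometry.HodgeTheory.AbelianLowDimension.NonSimpleFourfolds

variable {X Y Z E E' E₁ E₂ E₃ E₄ E₅ T S S₁ S₂ : AbelianVariety ℂ}

/-! ### §1 Poincaré for fivefolds; domination helpers -/

/-- **A non-simple complex abelian fivefold is isogenous to `Y × Z` with `(dim Y, dim Z) = (1,4)` or `(2,3)`**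
(Poincaré's complete reducibility: an abelian subvariety `B ↪ X`, `0 < dim B < 5`, and its complement; if `dim B ≥ 3`
use the complement of the complement). [cite: MumfordAV1970, §19 Thm. 1 (pp. 173–174)] [cite: MoonenZarhin1999LowDim, §5 (5.6)–(5.11)] -/
theorem exists_prod_isIsogenous_of_not_isSimple_fivefold (hX5 : X.dim = 5) (hX : ¬ X.IsSimple) :
    ∃ Y Z : AbelianVariety ℂ, (Y.dim = 1 ∧ Z.dim = 4 ∨ Y.dim = 2 ∧ Z.dim = 3) ∧
      AbelianVariety.IsIsogenous (Y.prod Z) X := by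
  obtain ⟨B, f, hf, hB0, hBX⟩ := exists_abelianSubvariety_of_not_isSimple hX
  haveI := hf
  obtain ⟨Z, j, hj, hσ⟩ := poincare_complete_reducibility f
  haveI := hj
  have hdim : B.dim + Z.dim = X.dim := by
    rw [← dim_prod, ← dim_eq_of_isIsogeny (isIsogeny_hom_of_iso (biprodIsoProd B Z)), dim_eq_of_isIsogeny hσ]
  rcases Nat.lt_or_ge B.dim 3 with hB12 | hB3
  · refine ⟨B, Z, by omega, (biprodIsoProd B Z).inv ≫ biprod.desc f j, ?_⟩
    exact isIsogeny_comp (isIsogeny_hom_of_iso (biprodIsoProd B Z).symm) hσ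
  · obtain ⟨Z', j', -, hσ'⟩ := poincare_complete_reducibility j
    have hdim' : Z.dim + Z'.dim = X.dim := by
      rw [← dim_prod, ← dim_eq_of_isIsogeny (isIsogeny_hom_of_iso (biprodIsoProd Z Z')), dim_eq_of_isIsogeny hσ']
    refine ⟨Z, Z', by omega, (biprodIsoProd Z Z').inv ≫ biprod.desc j j', ?_⟩
    exact isIsogeny_comp (isIsogeny_hom_of_iso (biprodIsoProd Z Z').symm) hσ'

/-- `A × (B × C) ∼ B × (A × C)`. [cite: MumfordAV1970, §19 (p. 169)] -/
theorem isIsogenous_prod_leftComm (A B C : AbelianVariety ℂ) :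
    AbelianVariety.IsIsogenous (A.prod (B.prod C)) (B.prod (A.prod C)) :=
  (isIsogenous_prod_assoc A B C).symm'.trans (isIsogenous_prodRotate A B C)

/-- An isogeny factor `S` of `A × B` with `Hom(S, A) = 0` is an isogeny factor of `B`. [cite: MumfordAV1970, §19 Thm. 1 and Cor. 1 (pp. 173–174)] -/
theorem avDominatedBy_right_of_forall_hom_eq_zero {A B : AbelianVariety ℂ} (h : AVDominatedBy S (A.prod B))
    (hSA : ∀ f : S ⟶ A, f = 0) : AVDominatedBy S B := by
  obtain ⟨s, π, N, hN, hsπ⟩ := h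
  refine ⟨s ≫ AbelianVariety.snd A B, AbelianVariety.prodLift 0 (𝟙 B) ≫ π, N, hN, ?_⟩
  have hs : s = (s ≫ AbelianVariety.snd A B) ≫ AbelianVariety.prodLift 0 (𝟙 B) := by
    apply prod_hom_ext
    · rw [Category.assoc, prodLift_fst, comp_zero, hSA (s ≫ AbelianVariety.fst A B)]
    · rw [Category.assoc, prodLift_snd, Category.comp_id]
  rw [← Category.assoc, ← hs, hsπ]

/-- **An isogeny factor of an abelian variety of CM type is of CM type** (Milne: quotients of CM abelian varieties are
CM; `s ≫ π = [N]` makes `π` surjective). [cite: Milne1999, §2 p. 54] [cite: MumfordAV1970, §19 Thm. 1 (pp. 173–174)] -/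
theorem isOfCMType_of_avDominatedBy (hX : IsOfCMType X) (h : AVDominatedBy E X) : IsOfCMType E := by
  obtain ⟨s, π, N, hN, hsπ⟩ := h
  exact hX.of_comp_eq_nsmul_id s π hN hsπ

/-- Two elliptic curves with a non-zero homomorphism between them are isogenous. [cite: MumfordAV1970, §19 Cor. 2 of Thm. 1 (p. 174)] -/
theorem isIsogenous_of_hom_ne_zero_of_curves (hE' : E'.dim = 1) (hE : E.dim = 1) {f : E' ⟶ E} (hf : f ≠ 0) :
    AbelianVariety.IsIsogenous E' E :=
  ⟨f, isIsogeny_of_isSimple_of_ne_zero (isSimple_of_dim_le_one hE'.le) (isSimple_of_dim_le_one hE.le) f hf⟩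

/-- «Not (e)/(f)» relative to `X` passes to every isogeny factor `W` of `X` (domination is transitive). [cite: MumfordAV1970, §19 Thm. 1 (pp. 173–174)] -/
theorem not_exists_caseEF_of_avDominatedBy {W : AbelianVariety ℂ} (hWX : AVDominatedBy W X)
    (hna : ¬ ∃ E T : AbelianVariety ℂ, E.dim = 1 ∧ IsOfCMType E ∧ T.IsSimple ∧ T.dim = 3 ∧
      AVDominatedBy E X ∧ AVDominatedBy T X ∧ Nonempty (E.endAlgebra →+* T.endAlgebra)) :
    ¬ ∃ E T : AbelianVariety ℂ, E.dim = 1 ∧ IsOfCMType E ∧ T.IsSimple ∧ T.dim = 3 ∧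
      AVDominatedBy E W ∧ AVDominatedBy T W ∧ Nonempty (E.endAlgebra →+* T.endAlgebra) := by
  rintro ⟨E, T, hE, hEcm, hTs, hT3, hEW, hTW, hne⟩
  exact hna ⟨E, T, hE, hEcm, hTs, hT3, hEW.trans hWX, hTW.trans hWX, hne⟩

/-- «Not (e)/(f)» gives, for an elliptic curve `E` and a simple threefold `T` dominated by `X`, the printed
non-embedding `End⁰(E) ↪̸ End⁰(T)` as soon as `E` has complex multiplication — the hypothesis of the tree's complete
`E × T` row. [cite: MoonenZarhin1999LowDim, Thm. 0.2 (e), (f) and Prop. (3.8)] -/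
theorem isEmpty_ringHom_of_not_exists_caseEF (hE : E.dim = 1) (hTs : T.IsSimple) (hT3 : T.dim = 3)
    (hEX : AVDominatedBy E X) (hTX : AVDominatedBy T X)
    (hna : ¬ ∃ E T : AbelianVariety ℂ, E.dim = 1 ∧ IsOfCMType E ∧ T.IsSimple ∧ T.dim = 3 ∧
      AVDominatedBy E X ∧ AVDominatedBy T X ∧ Nonempty (E.endAlgebra →+* T.endAlgebra)) :
    IsOfCMType E → IsEmpty (E.endAlgebra →+* T.endAlgebra) := by
  intro hEcm
  by_contra hne
  rw [not_isEmpty_iff] at hne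
  exact hna ⟨E, T, hE, hEcm, hTs, hT3, hEX, hTX, hne⟩

/-! ### §2 The rows -/

/-- **Products of five elliptic curves are stably nondegenerate** (multi-curve slots; Cor. (3.9) / van Geemen Thm. 4.3
stably). [cite: MoonenZarhin1999LowDim, Cor. (3.9)] [cite: vanGeemen1994HodgeAV, Thm. 4.3] -/
theorem isStablyNondegenerate_fiveCurves (h₁ : E₁.dim = 1) (h₂ : E₂.dim = 1) (h₃ : E₃.dim = 1) (h₄ : E₄.dim = 1)
    (h₅ : E₅.dim = 1) : IsStablyNondegenerate ((((E₁.prod E₂).prod E₃).prod E₄).prod E₅) := by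
  have h := isStablyNondegenerate_multiPowSucc 4 ![E₁, E₂, E₃, E₄, E₅] (fun _ => 0)
    (fun i => by fin_cases i <;> simp [h₁, h₂, h₃, h₄, h₅])
  exact h

/-- The same in the right-nested shape `E₁ × (E₂ × (E₃ × (E₄ × E₅)))`. [cite: MoonenZarhin1999LowDim, Cor. (3.9)] -/
theorem isStablyNondegenerate_fiveCurves' (h₁ : E₁.dim = 1) (h₂ : E₂.dim = 1) (h₃ : E₃.dim = 1) (h₄ : E₄.dim = 1)
    (h₅ : E₅.dim = 1) : IsStablyNondegenerate (E₁.prod (E₂.prod (E₃.prod (E₄.prod E₅)))) :=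
  (((isStablyNondegenerate_fiveCurves h₁ h₂ h₃ h₄ h₅).of_isIsogenous'
    (isIsogenous_prod_assoc ((E₁.prod E₂).prod E₃) E₄ E₅)).of_isIsogenous'
    (isIsogenous_prod_assoc (E₁.prod E₂) E₃ (E₄.prod E₅))).of_isIsogenous' (isIsogenous_prod_assoc E₁ E₂ _)

/-- **`E × (E₁ × (E₂ × S))` is stably nondegenerate for `E` an elliptic curve WITHOUT complex multiplication, `E₁`,
`E₂` any elliptic curves and `S` any SIMPLE abelian surface** — no further hypothesis. The cofactor `E₁ × (E₂ × S)` is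
stably nondegenerate (gen 58: `E₁ ×` a non-simple threefold); if `Hom(E₁ × E₂ × S, E) = 0` this is the `A × E` row
(Lemma (3.4)); if `Eᵢ ∼ E` then `X ∼ E² × (E_j × S)`, mixed powers of the fourfold `E × (E_j × S)` (Lemma (3.4) for
`E ×` any threefold). [cite: MoonenZarhin1999LowDim, §5 (5.6), (5.9), Lemma (3.4) and Prop. (3.8)]
[cite: vanGeemen1994HodgeAV, Lemma 3.7 and §3.6] -/
theorem isStablyNondegenerate_nonCMCurve_prod_curve_prod_curve_prod_simpleSurface (hE : E.dim = 1)
    (hEend : Module.finrank ℚ E.endAlgebra = 1) (h₁ : E₁.dim = 1) (h₂ : E₂.dim = 1) (hS : S.IsSimple)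
    (hS2 : S.dim = 2) : IsStablyNondegenerate (E.prod (E₁.prod (E₂.prod S))) := by
  have hEs : E.IsSimple := isSimple_of_dim_le_one hE.le
  have hSE : ∀ g : S ⟶ E, g = 0 := hom_eq_zero_of_isSimple_of_dim_ne hS hEs (by omega)
  by_cases h1E : ∀ f : E₁ ⟶ E, f = 0
  · by_cases h2E : ∀ f : E₂ ⟶ E, f = 0
    · -- `Hom(E₁ × (E₂ × S), E) = 0`: the `A × E` row with `A = E₁ × (E₂ × S)` stably nondegenerate
      have hW : IsStablyNondegenerate (E₁.prod (E₂.prod S)) :=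
        isStablyNondegenerate_curve_prod_threefold_of_not_isSimple h₁ (by rw [dim_prod]; omega)
          (not_isSimple_prod_of_dim_pos (by omega) (by omega))
      exact (hW.prod_nonCMCurve_of_forall_hom_eq_zero hE hEend
        (prod_hom_eq_zero_of_forall h1E (prod_hom_eq_zero_of_forall h2E hSE))).of_isIsogenous'
        (isIsogenous_prod_comm _ E)
    · -- `E₂ ∼ E`: `X ∼ E² × (E₁ × S)`
      push Not at h2E
      obtain ⟨f, hf⟩ := h2E
      have h2iso := isIsogenous_of_hom_ne_zero_of_curves h₂ hE hf
      have hD : IsStablyNondegenerate ((E.powSucc 1).prod ((E₁.prod S).powSucc 0)) :=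
        (isStablyNondegenerate_nonCMCurve_prod_threefold (T := E₁.prod S) (by rw [dim_prod]; omega) hE
          hEend).powSucc_prod_powSucc 1 0
      change IsStablyNondegenerate ((E.prod E).prod (E₁.prod S)) at hD
      exact (hD.of_isIsogenous' (isIsogenous_prod_assoc E E (E₁.prod S))).of_isIsogenous
        ((AbelianVariety.IsIsogenous.refl E).prod ((isIsogenous_prod_leftComm E₁ E₂ S).trans
          (h2iso.prod (AbelianVariety.IsIsogenous.refl _))))
  · -- `E₁ ∼ E`: `X ∼ E² × (E₂ × S)`
    push Not at h1E
    obtain ⟨f, hf⟩ := h1E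
    have h1iso := isIsogenous_of_hom_ne_zero_of_curves h₁ hE hf
    have hD : IsStablyNondegenerate ((E.powSucc 1).prod ((E₂.prod S).powSucc 0)) :=
      (isStablyNondegenerate_nonCMCurve_prod_threefold (T := E₂.prod S) (by rw [dim_prod]; omega) hE
        hEend).powSucc_prod_powSucc 1 0
    change IsStablyNondegenerate ((E.prod E).prod (E₂.prod S)) at hD
    exact (hD.of_isIsogenous' (isIsogenous_prod_assoc E E (E₂.prod S))).of_isIsogenous
      ((AbelianVariety.IsIsogenous.refl E).prod (h1iso.prod (AbelianVariety.IsIsogenous.refl _)))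

/-- **`E × (E₁ × (E₂ × S))` for three elliptic curves and ANY abelian surface `S`, the product NOT of CM type, is
stably nondegenerate** (`S` non-simple: five elliptic curves; `S` simple non-CM: the `Y × S` row, `dim Y = 3`; `S` simple
CM: some curve is non-CM, and the previous theorem after a shuffle). [cite: MoonenZarhin1999LowDim, §5 (5.6)–(5.9), (5.11) and Cor. (3.9)]
[cite: Milne1999, §2 p. 54] -/
theorem isStablyNondegenerate_curve_prod_curve_prod_curve_prod_surface_of_not_isOfCMType (hE : E.dim = 1)
    (h₁ : E₁.dim = 1) (h₂ : E₂.dim = 1) (hS2 : S.dim = 2) (hcm : ¬ IsOfCMType (E.prod (E₁.prod (E₂.prod S)))) :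
    IsStablyNondegenerate (E.prod (E₁.prod (E₂.prod S))) := by
  by_cases hS : S.IsSimple
  swap
  · -- `S ∼ E₃ × E₄`: five elliptic curves
    obtain ⟨E₃, E₄, h₃, h₄, hSiso⟩ := exists_curve_prod_curve_isIsogenous_of_not_isSimple_surface hS2 hS
    exact (isStablyNondegenerate_fiveCurves' hE h₁ h₂ h₃ h₄).of_isIsogenous'
      ((AbelianVariety.IsIsogenous.refl E).prod ((AbelianVariety.IsIsogenous.refl E₁).prod
        ((AbelianVariety.IsIsogenous.refl E₂).prod hSiso)))
  by_cases hScm : IsOfCMType S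
  swap
  · -- `S` simple, not of CM type: `S × (E × (E₁ × E₂))`
    have hD : IsStablyNondegenerate (S.prod (E.prod (E₁.prod E₂))) :=
      isStablyNondegenerate_simpleSurface_prod_of_dim_le_three hS hS2 hScm (by rw [dim_prod]; omega)
        (by rw [dim_prod, dim_prod]; omega)
    exact ((hD.of_isIsogenous' (isIsogenous_prod_comm S _)).of_isIsogenous'
      (isIsogenous_prod_assoc E (E₁.prod E₂) S)).of_isIsogenous'
      ((AbelianVariety.IsIsogenous.refl E).prod (isIsogenous_prod_assoc E₁ E₂ S))
  by_cases hEcm : IsOfCMType E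
  · by_cases h1cm : IsOfCMType E₁
    · by_cases h2cm : IsOfCMType E₂
      · exact absurd (hEcm.prod (h1cm.prod (h2cm.prod hScm))) hcm
      · -- `E₂` non-CM: `E₂ × (E × (E₁ × S))`, shuffled
        exact ((isStablyNondegenerate_nonCMCurve_prod_curve_prod_curve_prod_simpleSurface h₂
          (finrank_endAlgebra_eq_one_of_curve_of_not_isOfCMType h₂ h2cm) hE h₁ hS hS2).of_isIsogenous'
          (isIsogenous_prod_leftComm E₂ E (E₁.prod S))).of_isIsogenous'
          ((AbelianVariety.IsIsogenous.refl E).prod (isIsogenous_prod_leftComm E₂ E₁ S))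
    · -- `E₁` non-CM: `E₁ × (E × (E₂ × S))`, shuffled
      exact (isStablyNondegenerate_nonCMCurve_prod_curve_prod_curve_prod_simpleSurface h₁
        (finrank_endAlgebra_eq_one_of_curve_of_not_isOfCMType h₁ h1cm) hE h₂ hS hS2).of_isIsogenous'
        (isIsogenous_prod_leftComm E₁ E (E₂.prod S))
  · exact isStablyNondegenerate_nonCMCurve_prod_curve_prod_curve_prod_simpleSurface hE
      (finrank_endAlgebra_eq_one_of_curve_of_not_isOfCMType hE hEcm) h₁ h₂ hS hS2

/-- **`E × (S₁ × S₂)` for an elliptic curve and two abelian surfaces, the product NOT of CM type, is stably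
nondegenerate** (a non-simple `Sᵢ ∼ E₁ × E₂`: the previous theorem; both simple: `E` non-CM ⟹ `Hom(S₁ × S₂, E) = 0` and
the `A × E` row over `S₁ × S₂` (stably nondegenerate, gen 58); `E` CM ⟹ some `Sᵢ` is simple non-CM, the `S × Y` row
with `dim Y = 3`). [cite: MoonenZarhin1999LowDim, §5 (5.6)–(5.9), (5.11), Lemma (3.4)] [cite: Milne1999, §2 p. 54] -/
theorem isStablyNondegenerate_curve_prod_surface_prod_surface_of_not_isOfCMType (hE : E.dim = 1) (h₁ : S₁.dim = 2)
    (h₂ : S₂.dim = 2) (hcm : ¬ IsOfCMType (E.prod (S₁.prod S₂))) : IsStablyNondegenerate (E.prod (S₁.prod S₂)) := by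
  have hEs : E.IsSimple := isSimple_of_dim_le_one hE.le
  by_cases hs₁ : S₁.IsSimple
  swap
  · obtain ⟨E₁, E₂, hE₁, hE₂, hS₁iso⟩ := exists_curve_prod_curve_isIsogenous_of_not_isSimple_surface h₁ hs₁
    have hrel : AbelianVariety.IsIsogenous (E.prod (E₁.prod (E₂.prod S₂))) (E.prod (S₁.prod S₂)) :=
      (AbelianVariety.IsIsogenous.refl E).prod (((isIsogenous_prod_assoc E₁ E₂ S₂).symm').trans
        (hS₁iso.prod (AbelianVariety.IsIsogenous.refl S₂)))
    exact (isStablyNondegenerate_curve_prod_curve_prod_curve_prod_surface_of_not_isOfCMType hE hE₁ hE₂ h₂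
      (fun h => hcm ((isOfCMType_iff_of_isIsogenous hrel).1 h))).of_isIsogenous' hrel
  by_cases hs₂ : S₂.IsSimple
  swap
  · obtain ⟨E₁, E₂, hE₁, hE₂, hS₂iso⟩ := exists_curve_prod_curve_isIsogenous_of_not_isSimple_surface h₂ hs₂
    have hrel : AbelianVariety.IsIsogenous (E.prod (E₁.prod (E₂.prod S₁))) (E.prod (S₁.prod S₂)) :=
      (AbelianVariety.IsIsogenous.refl E).prod ((((isIsogenous_prod_assoc E₁ E₂ S₁).symm').trans
        (isIsogenous_prod_comm _ S₁)).trans ((AbelianVariety.IsIsogenous.refl S₁).prod hS₂iso))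
    exact (isStablyNondegenerate_curve_prod_curve_prod_curve_prod_surface_of_not_isOfCMType hE hE₁ hE₂ h₁
      (fun h => hcm ((isOfCMType_iff_of_isIsogenous hrel).1 h))).of_isIsogenous' hrel
  -- both surfaces simple
  by_cases hEcm : IsOfCMType E
  swap
  · have hSS : IsStablyNondegenerate (S₁.prod S₂) := isStablyNondegenerate_surface_prod_surface h₁ h₂
    exact (hSS.prod_nonCMCurve_of_forall_hom_eq_zero hE (finrank_endAlgebra_eq_one_of_curve_of_not_isOfCMType hE hEcm)
      (prod_hom_eq_zero_of_forall (hom_eq_zero_of_isSimple_of_dim_ne hs₁ hEs (by omega))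
        (hom_eq_zero_of_isSimple_of_dim_ne hs₂ hEs (by omega)))).of_isIsogenous' (isIsogenous_prod_comm _ E)
  by_cases hc₁ : IsOfCMType S₁
  · by_cases hc₂ : IsOfCMType S₂
    · exact absurd (hEcm.prod (hc₁.prod hc₂)) hcm
    · -- `S₂` simple non-CM: `S₂ × (E × S₁)`
      have hD : IsStablyNondegenerate (S₂.prod (E.prod S₁)) :=
        isStablyNondegenerate_simpleSurface_prod_of_dim_le_three hs₂ h₂ hc₂ (by rw [dim_prod]; omega)
          (by rw [dim_prod]; omega)
      exact (hD.of_isIsogenous' (isIsogenous_prod_leftComm S₂ E S₁)).of_isIsogenous'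
        ((AbelianVariety.IsIsogenous.refl E).prod (isIsogenous_prod_comm S₂ S₁))
  · -- `S₁` simple non-CM: `S₁ × (E × S₂)`
    have hD : IsStablyNondegenerate (S₁.prod (E.prod S₂)) :=
      isStablyNondegenerate_simpleSurface_prod_of_dim_le_three hs₁ h₁ hc₁ (by rw [dim_prod]; omega)
        (by rw [dim_prod]; omega)
    exact hD.of_isIsogenous' (isIsogenous_prod_leftComm S₁ E S₂)

/-- **`S × T` for a SIMPLE surface `S` and ANY threefold `T`, the product NOT of CM type, is stably nondegenerate —
GIVEN the row (5.10)** (`hST`, asked only for `T` with a factor of Type IV and not of CM type): `S` non-CM ⟹ the `T × S`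
row (Lemma (3.4) with (2.2)); `S` CM and `T` without factor of Type IV ⟹ Thm. (3.2)(2) (`T` satisfies (D), dimension
`3`); `T` CM ⟹ the product would be CM; else `hST`.
[cite: MoonenZarhin1999LowDim, §5 (5.6)–(5.8), (5.10), Thm. (3.2)(2), Lemmas (3.4), (3.6)] [cite: Milne1999, §2 p. 54] -/
theorem isStablyNondegenerate_simpleSurface_prod_threefold_of_not_isOfCMType_of (hS2 : S.dim = 2)
    (hS : S.IsSimple) (hT3 : T.dim = 3) (hcm : ¬ IsOfCMType (S.prod T))
    (hST : ¬ IsOfCMType T → ¬ HasNoTypeIVFactor T → IsOfCMType S → IsStablyNondegenerate (S.prod T)) :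
    IsStablyNondegenerate (S.prod T) := by
  by_cases hScm : IsOfCMType S
  swap
  · exact (isStablyNondegenerate_threefold_prod_simpleSurface hT3 hS hS2 hScm).of_isIsogenous' (isIsogenous_prod_comm T S)
  by_cases hT4 : HasNoTypeIVFactor T
  · exact ((isStablyNondegenerate_of_dim_pos_of_dim_le_three (X := T) (by omega)
      hT3.le).prod_of_hasNoTypeIVFactor_of_isSimple_of_isOfCMType_of_dim_le_three hT4 hS (by omega) (by omega)
      hScm).of_isIsogenous' (isIsogenous_prod_comm T S)
  by_cases hTcm : IsOfCMType T
  · exact absurd (hScm.prod hTcm) hcm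
  exact hST hTcm hT4 hScm

end Literature.AlgebraicGeometry.HodgeTheory.AbelianLowDimension.NonSimpleFivefolds

end

/-! ## Part 3: LowDimensionHodgeOfMarkman -/

noncomputable section

open _root_.CategoryTheory _root_.CategoryTheory.Limits

namespace Literature.AlgebraicGeometry.HodgeTheory.AbelianLowDimension.LowDimOfMarkman

open Literature.AlgebraicGeometry.Motives (AbelianVariety)
open Literature.AlgebraicGeometry.Motives.AbelianVariety
open Literature.AlgebraicGeometry.HodgeTheory
open Literature.AlgebraicGeometry.ComplexMultiplication
open Literature.AlgebraicGeometry.Milne1999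
open Literature.AlgebraicGeometry.ComplexMultiplication.Domination
open Literature.AlgebraicGeometry.HodgeTheory.AbelianLowDimension.NonSimpleFourfolds
open Literature.AlgebraicGeometry.HodgeTheory.AbelianLowDimension.NonSimpleFivefolds

variable {X A E T : AbelianVariety ℂ}

/-! ### §1 Isogeny factors: complements and the printed shapes of cases (a), (e), (f) -/

/-- **An isogeny factor has a complement**: if `A ≼ X` (`s ≫ π = [N]_A`, `N ≠ 0`), then `A × B ∼ X` for an abelian
subvariety `B` of `X` with `dim A + dim B = dim X` (Poincaré's complete reducibility in the quasi-retraction form of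
the tree, `exists_complement_of_quasiRetraction`: `B = im([N]_X - π ≫ s)`). [cite: MumfordAV1970, §19 Thm. 1 (pp. 173–174)] -/
theorem exists_prod_isIsogenous_of_avDominatedBy (h : AVDominatedBy A X) :
    ∃ B : AbelianVariety ℂ, A.dim + B.dim = X.dim ∧ AbelianVariety.IsIsogenous (A.prod B) X := by
  obtain ⟨s, π, N, hN, hsπ⟩ := h
  obtain ⟨B, j, -, -, hσ, -, hdim, -, -⟩ := exists_complement_of_quasiRetraction s π hN hsπ
  exact ⟨B, hdim, (biprodIsoProd A B).inv ≫ biprod.desc s j,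
    isIsogeny_comp (isIsogeny_hom_of_iso (biprodIsoProd A B).symm) hσ⟩

/-- Homomorphisms FROM a simple abelian variety to one of smaller dimension vanish (`Hom(T, E) = 0 ⟺ Hom(E, T) = 0`,
and a non-zero homomorphism into a simple `T` is surjective). [cite: MumfordAV1970, §19 Cor. 2 of Thm. 1 (p. 174)] -/
theorem hom_eq_zero_of_isSimple_of_lt_dim (hT : T.IsSimple) (h : E.dim < T.dim) (f : T ⟶ E) : f = 0 :=
  (Literature.AlgebraicGeometry.HodgeTheory.AbelianVariety.forall_hom_eq_zero_comm).1
    (hom_eq_zero_of_isSimple_of_dim_lt hT h) f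

/-- **Relative complement of an elliptic factor.** If an elliptic curve `E` and a simple threefold `T` are isogeny
factors of `X`, then `X ∼ E × B` with `dim B + 1 = dim X` and `T` an isogeny factor of `B` (`Hom(T, E) = 0`, so the
section of `T` into `E × B` has zero `E`-component — the tree's `avDominatedBy_right_of_forall_hom_eq_zero`).
[cite: MumfordAV1970, §19 Thm. 1 and Cor. 1–2 (pp. 173–174)] -/
theorem exists_prod_isIsogenous_of_avDominatedBy_curve_threefold (hE : E.dim = 1) (hTs : T.IsSimple)
    (hT3 : T.dim = 3) (hEX : AVDominatedBy E X) (hTX : AVDominatedBy T X) :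
    ∃ B : AbelianVariety ℂ, B.dim + 1 = X.dim ∧ AbelianVariety.IsIsogenous (E.prod B) X ∧ AVDominatedBy T B := by
  obtain ⟨B, hdim, g, hg⟩ := exists_prod_isIsogenous_of_avDominatedBy hEX
  refine ⟨B, by omega, ⟨g, hg⟩, avDominatedBy_right_of_forall_hom_eq_zero (hTX.trans_isIsogeny_inv hg) ?_⟩
  exact hom_eq_zero_of_isSimple_of_lt_dim hTs (by omega)

/-- **FIVEFOLDS — the printed shapes of cases (e)/(f)**: if an elliptic curve `E` and a simple threefold `T` are isogeny
factors of a fivefold `X`, then `X ∼ C × (E × T)` for an elliptic curve `C` (the complement of `T` in the complement of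
`E`; `X ∼ E × B ∼ E × (T × C) ∼ C × (E × T)`). Case (e) is `C ∼ E`, case (f) is `C ≁ E`.
[cite: MoonenZarhin1999LowDim, Thm. 0.2 with cases (e), (f)] [cite: MumfordAV1970, §19 Thm. 1 and Cor. 1–2 (pp. 173–174)] -/
theorem exists_isIsogenous_curve_prod_of_avDominatedBy_of_dim_eq_five (hX5 : X.dim = 5) (hE : E.dim = 1)
    (hTs : T.IsSimple) (hT3 : T.dim = 3) (hEX : AVDominatedBy E X) (hTX : AVDominatedBy T X) :
    ∃ C : AbelianVariety ℂ, C.dim = 1 ∧ AbelianVariety.IsIsogenous X (C.prod (E.prod T)) := by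
  obtain ⟨B, hB, hEB, hTB⟩ := exists_prod_isIsogenous_of_avDominatedBy_curve_threefold hE hTs hT3 hEX hTX
  obtain ⟨C, hdim, hTC⟩ := exists_prod_isIsogenous_of_avDominatedBy hTB
  refine ⟨C, by omega, ?_⟩
  exact hEB.symm'.trans <| ((AbelianVariety.IsIsogenous.refl E).prod
    (hTC.symm'.trans (isIsogenous_prod_comm T C))).trans (isIsogenous_prod_leftComm E C T)

end Literature.AlgebraicGeometry.HodgeTheory.AbelianLowDimension.LowDimOfMarkman

end
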